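import Summits.ValiantsHypothesis.ValiantsHypothesis.Theorems.KPlusLogSqLawTropicalBThreeFourOrderKit
import Summits.ValiantsHypothesis.ValiantsHypothesis.Theorems.KPlusLogSqLawTropicalBThreeFiveBound

/-!
# Route «KPlusLogSqLaw», crux `TropicalB` (stmt-ValiantsHypothesis-19771) — certificate kit for ORDER-TYPE LAWS of the `(3,4)` row, part 2:
# soundness of the Farkas certificates, the refutation search and its soundness (with row relabelling)

HONEST FRAMING.  Second half of the kit `…ThreeFourOrderKit` (cell `pub-symmetroid`, seat val-sym-trop-p5 g12, 2026-08-28; `--supports … --as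
helper`).  No census claim in this file; the order-type law it serves is `…ThreeFourOrderTypeLaw`.  Nothing here bears on `TropicalB` in its
window, `WeakLifting`, the doors, `MatrixDescartes` (stmt-ValiantsHypothesis-18050) or VP ≠ VNP.

CONTENT.  `cert_sound` — a checked certificate (`certOK G pre es mus`) contradicts every realisation of the prefix `pre` by unique optima at strictly
increasing slopes, whenever the three facet forms are `≥ 0` on the exponent vector (Farkas: the multiplier-weighted sum of the strict dominance
gaps is positive; its valuation part vanishes by incidence balance; its slope part is `≤ 0` by summation by parts, `MasterLaw.abel_nonpos`);
`refute` / `refute_sound` (depth-first: pairwise-law dead, certified, or refuted recursively); `refute1` / `not_realised_of_refute1` (first term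
with the identity permutation vector; rows relabelled by `isDominant_relabel_iff`).  [folklore: LP duality; packaging: this cell]
-/

set_option linter.dupNamespace false
set_option autoImplicit false

namespace Summit.ValiantsHypothesis.ValiantsHypothesis.Theorems.KPlusLogSqLaw

namespace ThreeFourCore

open Summit.ValiantsHypothesis.ValiantsHypothesis.Theorems.MatrixDescartes.Negative
open Summit.ValiantsHypothesis.ValiantsHypothesis.Theorems.LacunarySymmetroidMatrixDescartes.TropicalCensus
open Summit.ValiantsHypothesis.ValiantsHypothesis.Theorems.KPlusLogSqLaw.ConvexPosition
open Summit.ValiantsHypothesis.ValiantsHypothesis.Theorems.KPlusLogSqLaw.HingeLaw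
open Finset

section CertSound

variable (d : Fin 4 → ℕ) (v ε : Fin 3 → Fin 3 → Fin 4 → ℤ)


/-- **soundness of a certificate.**  If `G₁, G₂, G₃ ≥ 0` on `d` and `certOK G pre es mus`, then the prefix `pre` is realised by no list of
unique optima at strictly increasing slopes (the Farkas / master-law argument: the weighted sum of the strict dominance gaps is positive, its
valuation part vanishes by balance and its slope part is `≤ 0` by summation by parts). [folklore: Farkas; this cell] -/
theorem cert_sound (G : (Fin 4 → ℤ) × (Fin 4 → ℤ) × (Fin 4 → ℤ))
    (hG1 : 0 ≤ form G.1 d) (hG2 : 0 ≤ form G.2.1 d) (hG3 : 0 ≤ form G.2.2 d)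
    (pre : List AT) (es : List Entry) (mus : List (ℕ × ℕ × ℕ)) (hc : certOK G pre es mus = true)
    (fut : List (ℤ × RT)) (habs : fut.map (fun f => abs f.2) = pre)
    (hdom : ∀ f ∈ fut, IsDominant d v ε f.1 f.2) (hinc : fut.Pairwise (fun f g => f.1 < g.1)) : False := by
  classical
  unfold certOK at hc
  simp only [Bool.and_eq_true, decide_eq_true_eq, List.all_eq_true] at hc
  obtain ⟨⟨⟨⟨hne, hent⟩, hbal⟩, hpre⟩, htot⟩ := hc
  -- realisation data by position
  set n := fut.length with hn
  have hlen : pre.length = n := by rw [← habs, List.length_map]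
  let dflt : ℤ × RT := (0, (1, ![0, 0, 0]))
  have habsd : abs dflt.2 = D0 := by unfold abs D0; rw [ThreeFive.coe_one_eq]
  let θf : ℕ → ℤ := fun k => (fut.getD k dflt).1
  let pk : ℕ → RT := fun k => (fut.getD k dflt).2
  have hpk : ∀ k, pre.getD k D0 = abs (pk k) := by
    intro k
    rw [← habs, ← habsd, List.getD_map]
  have hmem : ∀ k, k < n → fut.getD k dflt ∈ fut := fun k hk => by
    rw [List.getD_eq_getElem _ _ hk]; exact List.getElem_mem hk
  have hdomk : ∀ k, k < n → IsDominant d v ε (θf k) (pk k) := fun k hk => hdom _ (hmem k hk)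
  have hθ : ∀ k, k + 1 < n → θf k < θf (k + 1) := by
    intro k hk
    have h := List.pairwise_iff_getElem.mp hinc k (k + 1) (by omega) hk (by omega)
    simp only [θf]
    rw [List.getD_eq_getElem _ _ (by omega), List.getD_eq_getElem _ _ hk]
    exact h
  -- competitors
  let qh : Entry → RT := fun e => (toPerm e.2.1.1, e.2.1.2)
  have hqabs : ∀ e ∈ es, abs (qh e) = e.2.1 := by
    intro e he
    obtain ⟨⟨⟨⟨-, -⟩, hS⟩, -⟩, -⟩ := hent e he
    unfold abs; simp only [qh]; rw [coe_toPerm _ hS]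
  have hqpres : ∀ e ∈ es, termSign ε (qh e) ≠ 0 := by
    intro e he
    obtain ⟨⟨⟨⟨-, -⟩, hS⟩, -⟩, hinc'⟩ := hent e he
    refine termSign_ne_zero_of_present ε _ fun b => ?_
    obtain ⟨t, ht, htb⟩ := hinc' b
    rw [← habs] at ht
    obtain ⟨f, hf, rfl⟩ := List.mem_map.mp ht
    simp only [hasInc, abs, decide_eq_true_eq] at htb
    obtain ⟨h1, h2⟩ := htb
    have hp := present_of_termSign_ne_zero ε f.2 (hdom f hf).1 b
    simp only [qh, coe_toPerm _ hS]
    rwa [h1, h2] at hp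
  have hqne : ∀ e ∈ es, qh e ≠ pk e.1 := by
    intro e he h
    obtain ⟨⟨⟨⟨-, hneq⟩, -⟩, -⟩, -⟩ := hent e he
    apply hneq
    rw [hpk, ← h, hqabs e he]
  -- slope differences as forms
  let δS : Entry → ℤ := fun e => form (fun l => histA (pre.getD e.1 D0).2 l - histA e.2.1.2 l) d
  have hδS : ∀ e ∈ es, Summit.ValiantsHypothesis.ValiantsHypothesis.Theorems.LacunarySymmetroidMatrixDescartes.TropicalCensus.slope d (pk e.1) - Summit.ValiantsHypothesis.ValiantsHypothesis.Theorems.LacunarySymmetroidMatrixDescartes.TropicalCensus.slope d (qh e) = δS e := by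
    intro e he
    simp only [δS]
    rw [form_sub, slope_eq_form, slope_eq_form, hpk]
    unfold abs
    rfl
  -- the gaps
  let V : RT → ℤ := fun t => ∑ b, v (t.1 b) b (t.2 b)
  have hgap : ∀ e ∈ es, 1 ≤ θf e.1 * δS e - (V (pk e.1) - V (qh e)) := by
    intro e he
    obtain ⟨⟨⟨⟨hk, -⟩, -⟩, -⟩, -⟩ := hent e he
    have h := bracket d v ε (hdomk e.1 (hlen ▸ hk)) (hqpres e he) (hqne e he)
    rw [← hδS e he]
    simp only [V]
    linarith
  -- the weighted sum of gaps is positive …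
  have hpos : 0 < (es.map fun e => (e.2.2 : ℤ) * (θf e.1 * δS e - (V (pk e.1) - V (qh e)))).sum := by
    apply List.sum_pos
    · intro x hx
      obtain ⟨e, he, rfl⟩ := List.mem_map.mp hx
      obtain ⟨⟨⟨⟨-, -⟩, -⟩, hlam⟩, -⟩ := hent e he
      have : (1 : ℤ) ≤ e.2.2 := by exact_mod_cast hlam
      nlinarith [hgap e he]
    · intro h; apply hne; simpa using h
  -- … its valuation part vanishes by balance …
  have hV : (es.map fun e => (e.2.2 : ℤ) * (V (pk e.1) - V (qh e))).sum = 0 := by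
    have e1 : ∀ e ∈ es, (e.2.2 : ℤ) * (V (pk e.1) - V (qh e)) =
        ∑ x : Fin 3 × Fin 3 × Fin 4, ((e.2.2 : ℤ) * (indI (pre.getD e.1 D0) x - indI e.2.1 x)) * v x.1 x.2.1 x.2.2 := by
      intro e he
      simp only [V]
      rw [val_eq_ind, val_eq_ind, ← hqabs e he, ← hpk, ← Finset.sum_sub_distrib, Finset.mul_sum]
      exact Finset.sum_congr rfl fun x _ => by ring
    rw [List.map_congr_left e1, list_sum_comm]
    refine Finset.sum_eq_zero fun x _ => ?_
    rw [List.sum_map_mul_right]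
    have := hbal x
    unfold coef at this
    rw [this, zero_mul]
  -- … and its slope part is ≤ 0 by summation by parts.
  let E : ℕ → ℤ := fun k => (es.map fun e => if e.1 = k then (e.2.2 : ℤ) * δS e else 0).sum
  have hΘ : (es.map fun e => (e.2.2 : ℤ) * (θf e.1 * δS e)).sum = ∑ k ∈ range n, θf k * E k := by
    have e1 : ∀ e ∈ es, (e.2.2 : ℤ) * (θf e.1 * δS e) =
        ∑ k ∈ range n, (if e.1 = k then θf k * ((e.2.2 : ℤ) * δS e) else 0) := by
      intro e he
      obtain ⟨⟨⟨⟨hk, -⟩, -⟩, -⟩, -⟩ := hent e he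
      rw [Finset.sum_ite_eq, if_pos (mem_range.mpr (hlen ▸ hk))]; ring
    rw [List.map_congr_left e1, list_sum_comm]
    refine Finset.sum_congr rfl fun k _ => ?_
    simp only [E]
    rw [← List.sum_map_mul_left]
    congr 1
    refine List.map_congr_left fun e _ => ?_
    split_ifs <;> ring
  have hP : ∀ j, ∑ k ∈ range (j + 1), E k = form (Hvec pre es j) d := by
    intro j
    have e1 : ∑ k ∈ range (j + 1), E k = (es.map fun e => if e.1 ≤ j then (e.2.2 : ℤ) * δS e else 0).sum := by
      simp only [E]
      rw [← list_sum_comm]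
      congr 1
      refine List.map_congr_left fun e _ => ?_
      rw [Finset.sum_ite_eq]
      simp only [mem_range, Nat.lt_succ_iff]
    rw [e1]
    unfold Hvec
    rw [form_list_sum]
    congr 1
    refine List.map_congr_left fun e _ => ?_
    rw [form_ite]
  have hn1 : 1 ≤ n := by
    rw [← hlen]
    obtain ⟨e, he⟩ := List.exists_mem_of_ne_nil es hne
    obtain ⟨⟨⟨⟨hk, -⟩, -⟩, -⟩, -⟩ := hent e he
    omega
  have habel := Summit.ValiantsHypothesis.ValiantsHypothesis.Theorems.KPlusLogSqLaw.MasterLaw.abel_nonpos (n - 1)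
    (fun k => (θf k : ℚ)) (fun k => (E k : ℚ)) ?_ ?_ ?_
  rotate_left
  · intro k hk; exact_mod_cast (hθ k (by omega)).le
  · intro k hk
    have hj : k < pre.length - 1 := by rw [hlen]; exact hk
    have h := hpre ⟨k, hj⟩
    have : (0 : ℤ) ≤ ∑ i ∈ range (k + 1), E i := by
      rw [hP, h, form_comb]
      have h1 := (mus.getD k (0, 0, 0)).1.cast_nonneg (α := ℤ)
      have h2 := (mus.getD k (0, 0, 0)).2.1.cast_nonneg (α := ℤ)
      have h3 := (mus.getD k (0, 0, 0)).2.2.cast_nonneg (α := ℤ)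
      positivity
    exact_mod_cast this
  · have htot' : Hvec pre es (n - 1) = 0 := by rw [← hlen]; exact htot
    have : ∑ i ∈ range (n - 1 + 1), E i = 0 := by
      rw [hP, htot']; simp [form]
    exact_mod_cast this
  have hΘle : ∑ k ∈ range n, θf k * E k ≤ 0 := by
    have : (∑ k ∈ range (n - 1 + 1), (E k : ℚ) * (θf k : ℚ)) ≤ 0 := habel
    rw [Nat.sub_add_cancel hn1] at this
    have e2 : (∑ k ∈ range n, (E k : ℚ) * (θf k : ℚ)) = ((∑ k ∈ range n, θf k * E k : ℤ) : ℚ) := by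
      push_cast; exact Finset.sum_congr rfl fun k _ => by ring
    rw [e2] at this
    exact_mod_cast this
  -- contradiction
  have hsplit : (es.map fun e => (e.2.2 : ℤ) * (θf e.1 * δS e - (V (pk e.1) - V (qh e)))).sum =
      (es.map fun e => (e.2.2 : ℤ) * (θf e.1 * δS e)).sum - (es.map fun e => (e.2.2 : ℤ) * (V (pk e.1) - V (qh e))).sum := by
    rw [← sum_mul_sub]
  rw [hsplit, hV, hΘ, sub_zero] at hpos
  linarith

end CertSound

/-! ## 3. The search and its soundness -/

/-- all class vectors `Fin 3 → Fin 4`. -/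
def allCls : List (Fin 3 → Fin 4) :=
  (List.finRange 4).flatMap fun a => (List.finRange 4).flatMap fun b => (List.finRange 4).map fun c => ![a, b, c]

/-- every class vector is listed. -/
theorem mem_allCls (c : Fin 3 → Fin 4) : c ∈ allCls := by
  have h : ![c 0, c 1, c 2] = c := by funext b; fin_cases b <;> rfl
  rw [← h]
  unfold allCls
  simp only [List.mem_flatMap, List.mem_map, List.mem_finRange, true_and]
  exact ⟨c 0, c 1, c 2, rfl⟩

/-- candidate abstract terms with a prescribed class-count vector. -/
def cands (h : Fin 4 → ℤ) : List AT := S3V.flatMap fun σ => (allCls.filter fun c => histA c = h).map fun c => (σ, c)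

/-- the abstraction of a real term is a candidate for its own class-count vector. -/
theorem abs_mem_cands (t : RT) : abs t ∈ cands (histA t.2) := by
  unfold cands abs
  simp only [List.mem_flatMap, List.mem_map, List.mem_filter, decide_eq_true_eq]
  exact ⟨⇑t.1, mem_S3V t.1, t.2, ⟨mem_allCls t.2, rfl⟩, rfl⟩

/-- a certificate table row: prefix, entries, facet multipliers. -/
abbrev Cert := List AT × List Entry × List (ℕ × ℕ × ℕ)

/-- look up and check a certificate for the prefix `pre`. -/
def certFor (G : (Fin 4 → ℤ) × (Fin 4 → ℤ) × (Fin 4 → ℤ)) (tab : List Cert) (pre : List AT) : Bool :=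
  tab.any fun c => decide (c.1 = pre) && certOK G pre c.2.1 c.2.2

/-- **refutation search**: every way of realising the class-count vectors `rest` (in order, by any permutation vector and class vector) after
the placed abstract terms `asg` either violates the pairwise law against a placed term, or completes a certified prefix, or is refuted
recursively. -/
def refute (Gneg : List (Fin 4 → ℤ)) (G : (Fin 4 → ℤ) × (Fin 4 → ℤ) × (Fin 4 → ℤ)) (tab : List Cert) :
    List AT → List (Fin 4 → ℤ) → Bool
  | _, [] => false
  | asg, h :: rest => (cands h).all fun t =>
      (asg.any fun a => domL Gneg a t) || certFor G tab (asg ++ [t]) || refute Gneg G tab (asg ++ [t]) rest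

section SearchSound

variable (d : Fin 4 → ℕ) (v ε : Fin 3 → Fin 3 → Fin 4 → ℤ) (Gneg : List (Fin 4 → ℤ))
  (G : (Fin 4 → ℤ) × (Fin 4 → ℤ) × (Fin 4 → ℤ)) (tab : List Cert)

/-- **soundness of the search**: a refuted pattern is realised by no increasing family of unique optima (after any placed family). -/
theorem refute_sound (hGneg : ∀ g ∈ Gneg, form g d ≤ 0) (hG1 : 0 ≤ form G.1 d) (hG2 : 0 ≤ form G.2.1 d) (hG3 : 0 ≤ form G.2.2 d) :
    ∀ (rest : List (Fin 4 → ℤ)) (placed fut : List (ℤ × RT)),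
      refute Gneg G tab (placed.map fun a => abs a.2) rest = true →
      List.Forall₂ (fun f h => histA f.2.2 = h) fut rest →
      (∀ a ∈ placed ++ fut, IsDominant d v ε a.1 a.2) → (placed ++ fut).Pairwise (fun a b => a.1 < b.1) → False := by
  intro rest
  induction rest with
  | nil => intro placed fut hs; simp [refute] at hs
  | cons h rest ih =>
    intro placed fut hs hF hdom hpw
    cases hF with
    | cons hfh hrest =>
      rename_i f fut'
      simp only [refute, List.all_eq_true, Bool.or_eq_true, List.any_eq_true] at hs
      have hcand : abs f.2 ∈ cands h := by rw [← hfh]; exact abs_mem_cands f.2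
      have hfmem : f ∈ placed ++ f :: fut' := List.mem_append_right _ List.mem_cons_self
      rcases hs (abs f.2) hcand with (⟨a, ha, hdomL⟩ | hcert) | hrec
      · -- pairwise law against a placed term
        obtain ⟨a', ha', rfl⟩ := List.mem_map.mp ha
        have hlt : a'.1 < f.1 := by
          have hsub : [a', f].Sublist (placed ++ f :: fut') := by
            have h1 : [a'].Sublist placed := List.singleton_sublist.mpr ha'
            have h2 : [f].Sublist (f :: fut') := List.singleton_sublist.mpr List.mem_cons_self
            exact h1.append h2
          have := hpw.sublist hsub
          simp only [List.pairwise_cons, List.mem_singleton, forall_eq] at this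
          exact this.1
        exact domL_sound d v ε Gneg hGneg hlt a'.2 f.2 (hdom a' (List.mem_append_left _ ha')) (hdom f hfmem) hdomL
      · -- a certified prefix
        unfold certFor at hcert
        rw [List.any_eq_true] at hcert
        obtain ⟨c, -, hc⟩ := hcert
        rw [Bool.and_eq_true, decide_eq_true_eq] at hc
        obtain ⟨hc1, hc2⟩ := hc
        refine cert_sound d v ε G hG1 hG2 hG3 _ c.2.1 c.2.2 hc2 (placed ++ [f]) (by simp) ?_ ?_
        · intro a ha
          apply hdom
          rcases List.mem_append.mp ha with ha | ha
          · exact List.mem_append_left _ ha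
          · rw [List.mem_singleton] at ha; subst ha; exact hfmem
        · exact hpw.sublist (by simp)
      · -- recurse
        refine ih (placed ++ [f]) fut' (by simpa using hrec) hrest ?_ ?_
        · intro a ha; apply hdom; simpa using ha
        · simpa using hpw

/-- **a refuted pattern is realised by no dominant family**: corollary with nothing placed. -/
theorem not_realised_of_refute (hGneg : ∀ g ∈ Gneg, form g d ≤ 0) (hG1 : 0 ≤ form G.1 d) (hG2 : 0 ≤ form G.2.1 d)
    (hG3 : 0 ≤ form G.2.2 d) (pat : List (Fin 4 → ℤ)) (hs : refute Gneg G tab [] pat = true) (fut : List (ℤ × RT))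
    (hF : List.Forall₂ (fun f h => histA f.2.2 = h) fut pat) (hdom : ∀ a ∈ fut, IsDominant d v ε a.1 a.2)
    (hpw : fut.Pairwise (fun a b => a.1 < b.1)) : False :=
  refute_sound d v ε Gneg G tab hGneg hG1 hG2 hG3 pat [] fut (by simpa using hs) hF (by simpa using hdom) (by simpa using hpw)

/-- the search with the FIRST pattern term restricted to the identity permutation vector (rows relabelled). -/
def refute1 (Gneg : List (Fin 4 → ℤ)) (G : (Fin 4 → ℤ) × (Fin 4 → ℤ) × (Fin 4 → ℤ)) (tab : List Cert) :
    List (Fin 4 → ℤ) → Bool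
  | [] => false
  | h :: rest => (allCls.filter fun c => histA c = h).all fun c =>
      certFor G tab [(![0, 1, 2], c)] || refute Gneg G tab [(![0, 1, 2], c)] rest

/-- **a pattern refuted by `refute1` is realised by no dominant family** (rows relabelled by the first term's permutation; dominance
transfers by `isDominant_relabel_iff`). -/
theorem not_realised_of_refute1 (hGneg : ∀ g ∈ Gneg, form g d ≤ 0) (hG1 : 0 ≤ form G.1 d) (hG2 : 0 ≤ form G.2.1 d)
    (hG3 : 0 ≤ form G.2.2 d) (pat : List (Fin 4 → ℤ)) (hs : refute1 Gneg G tab pat = true) (fut : List (ℤ × RT))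
    (hF : List.Forall₂ (fun f h => histA f.2.2 = h) fut pat) (hdom : ∀ a ∈ fut, IsDominant d v ε a.1 a.2)
    (hpw : fut.Pairwise (fun a b => a.1 < b.1)) : False := by
  classical
  cases hF with
  | nil => simp [refute1] at hs
  | cons hfh hrest =>
    rename_i f h fut' rest
    -- relabel the rows by the permutation of the first term
    set π : Equiv.Perm (Fin 3) := f.2.1 with hπ
    let v' : Fin 3 → Fin 3 → Fin 4 → ℤ := fun a b l => v (π a) b l
    let ε' : Fin 3 → Fin 3 → Fin 4 → ℤ := fun a b l => ε (π a) b l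
    let rl : ℤ × RT → ℤ × RT := fun a => (a.1, (π⁻¹ * a.2.1, a.2.2))
    have hdom' : ∀ a ∈ f :: fut', IsDominant d v' ε' a.1 (rl a).2 := by
      intro a ha
      have hrel := (isDominant_relabel_iff d v ε π 1 (π⁻¹ * a.2.1, a.2.2) a.1).mp
      have e : ((π * (π⁻¹ * a.2.1) * (1 : Equiv.Perm (Fin 3))⁻¹ : Equiv.Perm (Fin 3)),
          fun j => a.2.2 (((1 : Equiv.Perm (Fin 3))⁻¹) j)) = a.2 := by
        ext1
        · ext1 x; simp
        · funext j; simp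
      rw [e] at hrel
      simpa [v', ε'] using hrel (hdom a ha)
    simp only [refute1, List.all_eq_true, Bool.or_eq_true, List.mem_filter, decide_eq_true_eq] at hs
    have hs' := hs f.2.2 ⟨mem_allCls _, hfh⟩
    have habs1 : [(![0, 1, 2], f.2.2)] = [rl f].map fun a => abs a.2 := by
      simp only [List.map_cons, List.map_nil, abs, rl]
      rw [hπ, inv_mul_cancel, ThreeFive.coe_one_eq]
    have hfut' : ∀ a ∈ fut', IsDominant d v' ε' (rl a).1 (rl a).2 := fun a ha => hdom' a (List.mem_cons_of_mem _ ha)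
    have hpw' : (List.map rl (f :: fut')).Pairwise (fun a b => a.1 < b.1) := by
      rw [List.pairwise_map]; exact hpw
    rcases hs' with hcert | hrec
    · unfold certFor at hcert
      rw [List.any_eq_true] at hcert
      obtain ⟨c, -, hc⟩ := hcert
      rw [Bool.and_eq_true, decide_eq_true_eq] at hc
      obtain ⟨hc1, hc2⟩ := hc
      refine cert_sound d v' ε' G hG1 hG2 hG3 _ c.2.1 c.2.2 hc2 [rl f] habs1.symm ?_ (List.pairwise_singleton _ _)
      intro a ha; rw [List.mem_singleton] at ha; subst ha; exact hdom' f List.mem_cons_self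
    · rw [habs1] at hrec
      refine refute_sound d v' ε' Gneg G tab hGneg hG1 hG2 hG3 rest [rl f] (fut'.map rl) hrec ?_ ?_ ?_
      · exact List.forall₂_map_left_iff.mpr (by simpa [rl] using hrest)
      · intro a ha
        rcases List.mem_append.mp ha with ha | ha
        · rw [List.mem_singleton] at ha; subst ha; exact hdom' f List.mem_cons_self
        · obtain ⟨a', ha', rfl⟩ := List.mem_map.mp ha; exact hfut' a' ha'
      · simpa using hpw'

end SearchSound

end ThreeFourCore

end Summit.ValiantsHypothesis.ValiantsHypothesis.Theorems.KPlusLogSqLaw
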